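import Summits.QuantumFields.YangMills.Theorems.IR.HaarCodingIndependence
import Literature.MathematicalPhysics.QuantumFieldTheory.YangMillsOS
import Literature.MathematicalPhysics.QuantumFieldTheory.LatticeGaugeProofs

/-!
# Line `haar-coding` (crux `IR`, stmt-QuantumFields-19354): the Haar-coded format and coded replacement of observables

Route `BalabanLadder`, crux `IR`, line `haar-coding` (ideator ym-ir-idea-4, skeleton `Cruxes/IR/Lines/haar_coding.lean`,
engine stub `stub_codedClustering` = E_cod), pooled prover `ym-ir-line-bsf-p1` (director-ym R366).  Bookkeeping for the
engine «Haar-coded ⇒ clustering» (file `…HaarCodingClustering`):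

* §1 the format `HaarCoded ρ K β b` (bodies identical to the skeleton's `supDist`, `inputBall`, `HaarCoded`, with
  `haarNoise` unfolded), and the torus geometry of input balls (`torusEdge_ne_of_separated`: input balls of radius `R`
  about time `0` and time `t` do not meet on the torus `(2S+1)⁴` when `2(R + D) < t ≤ S`);
* §2 the coded replacement of a cylinder observable: on the good event the observable of the coded field equals the
  observable of the local codes (`obs_coded_eq`), which depends only on the union of the input balls
  (`dependsOn_obs_codes`) and is measurable; the bad event of `#F` links has mass `≤ #F · K⁺ e^{-k}` (`measure_bad_le`).

Honest framing: plumbing; nothing here bears on the Yang–Mills mass gap (Clay).  R4 of the ladder closes only the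
conditional finite-𝕋⁴ rung `BalabanLadder.UV`.
Refs: Y. Spinka, Ann. Probab. 48 (2020) (arXiv:1803.10578); line card `Cruxes/IR/Lines/haar_coding.md`.
-/

set_option autoImplicit false

noncomputable section

open MeasureTheory Function Classical
open Literature.MathematicalPhysics.QuantumFieldTheory Literature.MathematicalPhysics.QuantumLattice

namespace Summit.QuantumFields.YangMills.Cruxes.IR.HaarCodingEngine

/-! ## §1 The format (bodies identical to the skeleton's) and the torus geometry of input balls -/

section Format

variable {G : Type} [Group G] [TopologicalSpace G] [IsTopologicalGroup G] [CompactSpace G]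
  [MeasurableSpace G] [BorelSpace G]

/-- Sup-distance of two sites of `ℤ⁴` (body identical to `HaarCoding.supDist`). -/
def supDist (x y : Fin 4 → ℤ) : ℕ := Finset.univ.sup fun i => (x i - y i).natAbs

/-- **Input ball** (body identical to `HaarCoding.inputBall`): the torus links below the `ℤ⁴`-links whose base
point is within sup-distance `R` of the base point of `e`. -/
def inputBall (S : ℕ) (e : Literature.MathematicalPhysics.QuantumLattice.ZdEdge 4) (R : ℕ) : Set (Edge 4 S) :=
  torusEdge S '' {e' : Literature.MathematicalPhysics.QuantumLattice.ZdEdge 4 | supDist e'.1 e.1 ≤ R}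

/-- **FORMAT C_K — Haar-coded at radius `b` with tail constant `K`** (body identical to `HaarCoding.HaarCoded`,
with `haarNoise` unfolded to the product Haar measure). -/
def HaarCoded {N : ℕ} (ρ : G →* Matrix (Fin N) (Fin N) ℂ) (K : ℝ) (β : ℝ) (b : ℕ) : Prop :=
  ∀ S : ℕ, b ≤ 2 * S + 1 →
    ∃ Φ : GaugeConfig 4 (2 * S + 1) G → GaugeConfig 4 (2 * S + 1) G, Measurable Φ ∧
      (Measure.pi fun _ : Edge 4 (2 * S + 1) => haarProbability G).map Φ =
        wilsonMeasure (d := 4) (L := 2 * S + 1) ρ β ∧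
      ∀ (e : Literature.MathematicalPhysics.QuantumLattice.ZdEdge 4) (k : ℕ), 1 ≤ k →
        ∃ Ψ : GaugeConfig 4 (2 * S + 1) G → G, Measurable Ψ ∧
          DependsOn Ψ (inputBall (2 * S + 1) e (k * b)) ∧
          (Measure.pi fun _ : Edge 4 (2 * S + 1) => haarProbability G)
              {ω | Φ ω (torusEdge (2 * S + 1) e) ≠ Ψ ω} ≤
            ENNReal.ofReal (K * Real.exp (-(k : ℝ)))

end Format

/-- A coordinate difference is bounded by the sup-distance. -/
theorem natAbs_sub_le_supDist (x y : Fin 4 → ℤ) (i : Fin 4) : (x i - y i).natAbs ≤ supDist x y :=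
  Finset.le_sup (f := fun i => (x i - y i).natAbs) (Finset.mem_univ i)

/-- **Input balls about time `0` and time `t` do not meet on the torus.**  If `z` is within sup-distance `R` of a
site `x` with `|x 0| ≤ D`, `z'` within `R` of a site `x'` with `|x' 0 − t| ≤ D`, and `2(R + D) < t ≤ S`, then the
torus links (side `2S+1`) below `(z, i)` and `(z', i')` are distinct. -/
theorem torusEdge_ne_of_separated {S R D t : ℕ} (hsep : 2 * (R + D) < t) (htS : t ≤ S) {x x' z z' : Fin 4 → ℤ}
    (hx : (x 0).natAbs ≤ D) (hx' : (x' 0 - t).natAbs ≤ D) (hz : supDist z x ≤ R) (hz' : supDist z' x' ≤ R)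
    (i i' : Fin 4) : torusEdge (2 * S + 1) (z, i) ≠ torusEdge (2 * S + 1) (z', i') := by
  intro h
  have h0 : ((z 0 : ℤ) : ZMod (2 * S + 1)) = ((z' 0 : ℤ) : ZMod (2 * S + 1)) := by
    have := congrArg (fun p : Edge 4 (2 * S + 1) => p.1 0) h
    simpa [torusEdge, Literature.Probability.LatticeModels.Torus.proj] using this
  rw [ZMod.intCast_eq_intCast_iff_dvd_sub] at h0
  have h1 := natAbs_sub_le_supDist z x 0
  have h2 := natAbs_sub_le_supDist z' x' 0
  have hd : 0 < z' 0 - z 0 ∧ z' 0 - z 0 < ((2 * S + 1 : ℕ) : ℤ) := by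
    push_cast; omega
  have hle := Int.le_of_dvd hd.1 h0
  omega

/-! ## §2 Coded replacement of a cylinder observable -/

section Replace

variable {G : Type} [Group G] [MeasurableSpace G] {L : ℕ}

omit [Group G] [MeasurableSpace G] in
/-- On the good event (every output link read by `O` equals its local code) the observable of the coded field is the
observable of the codes. -/
theorem obs_coded_eq (Φ : GaugeConfig 4 L G → GaugeConfig 4 L G) (Ψ : Literature.MathematicalPhysics.QuantumLattice.ZdEdge 4 → GaugeConfig 4 L G → G)
    {F : Finset (Literature.MathematicalPhysics.QuantumLattice.ZdEdge 4)} {O : LGConfig 4 G → ℝ} (hO : DependsOn O (↑F : Set (Literature.MathematicalPhysics.QuantumLattice.ZdEdge 4)))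
    {ω : GaugeConfig 4 L G} (hgood : ∀ z ∈ F, Φ ω (torusEdge L z) = Ψ z ω) :
    O (torusLift L (Φ ω)) = O (fun z => Ψ z ω) :=
  hO fun z hz => by simpa [torusLift] using hgood z (Finset.mem_coe.1 hz)

omit [Group G] [MeasurableSpace G] in
/-- The observable of the codes depends only on the union of the input balls of the links read. -/
theorem dependsOn_obs_codes (Ψ : Literature.MathematicalPhysics.QuantumLattice.ZdEdge 4 → GaugeConfig 4 L G → G) {F : Finset (Literature.MathematicalPhysics.QuantumLattice.ZdEdge 4)}
    {O : LGConfig 4 G → ℝ} (hO : DependsOn O (↑F : Set (Literature.MathematicalPhysics.QuantumLattice.ZdEdge 4))) (I : Literature.MathematicalPhysics.QuantumLattice.ZdEdge 4 → Set (Edge 4 L))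
    (hΨ : ∀ z ∈ F, DependsOn (Ψ z) (I z)) :
    DependsOn (fun ω : GaugeConfig 4 L G => O (fun z => Ψ z ω)) (⋃ z ∈ F, I z) := by
  intro ω ω' h
  apply hO
  intro z hz
  exact hΨ z (Finset.mem_coe.1 hz) fun q hq => h q (Set.mem_biUnion (Finset.mem_coe.1 hz) hq)

omit [Group G] in
/-- The observable of the codes is measurable. -/
theorem measurable_obs_codes {Ψ : Literature.MathematicalPhysics.QuantumLattice.ZdEdge 4 → GaugeConfig 4 L G → G} (hΨ : ∀ z, Measurable (Ψ z))
    {O : LGConfig 4 G → ℝ} (hO : Measurable O) :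
    Measurable fun ω : GaugeConfig 4 L G => O (fun z => Ψ z ω) :=
  hO.comp (measurable_pi_lambda _ fun z => hΨ z)

omit [Group G] in
/-- The bad event of a finite set of links has mass at most `#F · K⁺ e^{-k}`. -/
theorem measure_bad_le {ν : Measure (GaugeConfig 4 L G)} (Φ : GaugeConfig 4 L G → GaugeConfig 4 L G)
    (Ψ : Literature.MathematicalPhysics.QuantumLattice.ZdEdge 4 → GaugeConfig 4 L G → G) (F : Finset (Literature.MathematicalPhysics.QuantumLattice.ZdEdge 4)) {K : ℝ} {k : ℕ}
    (htail : ∀ z ∈ F, ν {ω | Φ ω (torusEdge L z) ≠ Ψ z ω} ≤ ENNReal.ofReal (K * Real.exp (-(k : ℝ)))) :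
    (ν (⋃ z ∈ F, {ω | Φ ω (torusEdge L z) ≠ Ψ z ω})).toReal ≤
      F.card * (max K 0 * Real.exp (-(k : ℝ))) := by
  have hK : K * Real.exp (-(k : ℝ)) ≤ max K 0 * Real.exp (-(k : ℝ)) :=
    mul_le_mul_of_nonneg_right (le_max_left _ _) (Real.exp_pos _).le
  have h0 : 0 ≤ max K 0 * Real.exp (-(k : ℝ)) := mul_nonneg (le_max_right _ _) (Real.exp_pos _).le
  refine ENNReal.toReal_le_of_le_ofReal (by positivity) ?_
  calc ν (⋃ z ∈ F, {ω | Φ ω (torusEdge L z) ≠ Ψ z ω})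
      ≤ ∑ z ∈ F, ν {ω | Φ ω (torusEdge L z) ≠ Ψ z ω} := measure_biUnion_finset_le _ _
    _ ≤ ∑ _z ∈ F, ENNReal.ofReal (max K 0 * Real.exp (-(k : ℝ))) :=
        Finset.sum_le_sum fun z hz => (htail z hz).trans (ENNReal.ofReal_le_ofReal hK)
    _ = ENNReal.ofReal (F.card * (max K 0 * Real.exp (-(k : ℝ)))) := by
        rw [Finset.sum_const, nsmul_eq_mul, ENNReal.ofReal_mul (Nat.cast_nonneg _), ENNReal.ofReal_natCast]

end Replace

end Summit.QuantumFields.YangMills.Cruxes.IR.HaarCodingEngine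

end
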